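import Summits.QuantumFields.YangMills.Theorems.UnitScaleTiltProp7CoarseGaugeEqFrameResponse
import Summits.QuantumFields.YangMills.Theorems.UnitScaleTiltProp7QSymEqTrueLinIter
import Summits.QuantumFields.YangMills.Theorems.UnitScaleTiltProp7EmlIterULinearPartEqTrueLinIterT3
import HarnessLib

/-!
# Route `UnitScaleTilt`, crux «MinimiserStabilityRegPr» (stmt-QuantumFields-19200, stub EX), positivity block (b1) — SEQUEL to ✓`UnitScaleTiltProp7CoarseGaugeEqFrameResponse`:
# **WITH LEG, THE SYMMETRIC-FRAME TWISTED AVERAGE IS THE TRUE LINEARISATION MINUS THE STAIR-MEAN PURE GAUGE — EXACTLY, NO RESIDUE**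

Cell `ym3-torus` (rung R3 — YM₃ on T³; NOT d = 4, NOT the Clay problem).  Width seat `ym3-torus-px13` g11 (frames∕intertwiner lineage); asked as a SEQUEL by the (b) holder
ym-ust-19200-w7 g10 (2026-08-29T21:08:51Z «the natural head of the (iv) file»).  THEOREMS ONLY (0 `def`, 0 `sorry`); `--supports stmt-QuantumFields-19200 --as helper`; count-neutral.

THE POINT.  LEG ✓`Prop7QSymEqTrueLinIter.QTwS_apply_eq_trueLinIter_sub_coarseGauge` says `QTwS A c = Q_{K−n}A(ĉ) − P_Ū(rA)(ĉ)` with `rA(y) = fderiv (t ↦ ↑frameTwS(eᵗW)(y)) 0 A`;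
✓`Prop7SymFrameLinearResponseStep.frameTwS_family_eq` says `frameTwS = frameAccU (K − n) W♭ (·) ∘ siteShift`; and ✓`Prop7CoarseGaugeEqFrameResponse.fderiv_frameAccU_eq_coarseGauge`
says `fderiv (t ↦ ↑v_k(t)(y)) 0 A = Λ_k(y)` for the STAIR-MEAN coarse gauge family `Λ` of STRUCTURE (✓`Prop7TrueLinIterStructure.trueLinIter_structure` with
`CM_j(ξ)(y) := |Idx|⁻¹·Σ_i covWalkSum V_j ξ (walk (emb y) st_i)`).  Substituting: **`QTwS A c = Q_{K−n}A(ĉ) − P_Ū(Λ_{K−n} ∘ siteShift)(ĉ)`** — the «coarse-gauge residue» (v) of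
w7-19200 g10's LOCATE-QCMP-B1 §2 is absent; with STRUCTURE instantiated at the same `Q` and this `CM` the right side is its reduced part `G_{K−n}(ĉ)` (that instantiation is the (b1) pen's),
and DEFECT ✓`Prop7TrueLinIterDefect.sqrt_sum_normSq_reduced_sub_lineIter_le` is stated for the SAME stair-mean `CM` (its `hGs` binder; ym-routeR-w4 g25 LOCATE 2026-08-29T21:16:04Z).

WHAT IS PROVED (ns `…Theorems.Prop7CoarseGaugeEqFrameResponseQTwS`): ★★★ `QTwS_apply_eq_trueLinIter_sub_stairGauge` — LEG's hypotheses VERBATIM (windows `10¹⁰L⁶ε₀ ≤ 1`,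
`10¹²L³ε₀ ≤ 1`, `RegPr`, the abstract true-linearised tower `Q` by `hQ0`∕`hQs`, 𝔰𝔲(2)-valued direction `A`) + `Λ`∕`hΛ0`∕`hΛs` (the stair-mean
coarse gauge family AT THE SU(2) TOWER OF RECORD `Ū⁽ᵏ⁾ = Averaging.iter (blockAvg expMeanLogSU) k W` — the `hΛs` text of ym-routeR-w4 g25's (iv′)-bridge §3, def-free), conclusion displayed
below.  Proof: the base identity at `V k := Ū⁽ᵏ⁾W` (`hV` by ✓`Prop8ChartAllL.coe_emlIterU_unitsField_T3_allL` from `RegPr`), then `rw [LEG, frameTwS_family_eq ×2, base ×2]`.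
v2 (APPEND): ★★ `QTwS_apply_eq_frameReduced_bondShift` — the same with `Q (K − n) A` replaced by the fderiv letter `ℓ_{K−n}A` and read at `bondShift c'` = the (R3) dock of
✓`Prop7SkewFrobRowAssembly.skewFrobRow_of_rows` (its `hR3` by `exact`, `G :=` ✓`Prop7TrueLinIterDefectOfStairGauge` §3's reduced family at `k = K − n`).
v3 (APPEND): ★ `exists_stairGauge_family` (the coupled stair-mean `Λ` exists, `Nat.rec`) · ★★ `exists_stairGauge_frameReduced_bondShift` (the dock packaged: `∃ Λ, hΛ0 ∧ hΛs ∧ (R3)`).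
HONEST SCOPE.  An identity over landed letters; no estimate; (iv) `S_k ↔ T^{str}`, `hQcmp`, the γ-row, the print rows, EX and the crux are NOT proved; STRUCTURE and DEFECT are not
instantiated here.

References: T. Bałaban, CMP **98** (1985) 17–51 [Balaban1985Averaging] ((58) p.27, (97) p.32); CMP **95** (1984) 17–40 [Balaban1984PropagatorsI] ((1.18)–(1.20) pp.19–20);
CMP **102** (1985) 277–309 [Balaban1985Variational] (Prop. 7 p.299).
-/

set_option autoImplicit false

noncomputable section

open scoped Matrix.Norms.L2Operator BigOperators

namespace Summit.QuantumFields.YangMills.Theorems.Prop7CoarseGaugeEqFrameResponseQTwS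

open Literature.MathematicalPhysics.QuantumFieldTheory.Balaban1983to89
open Literature.MathematicalPhysics.QuantumFieldTheory.Balaban1983to89.T3ContinuumYM3Torus
open T4Continuum BlockAveraging AveragingRT ExpMeanLog BlockAveragingEMLLinearised BlockAveragingEMLProp2
open T3PrintedRegularMinimiser (RegPr)
open T3SectALandauChart (bgUnits)
open T3LevelShift (siteShift bondShift)
open T3PrintedRegularOrbits (sites_eq)
open B7Prop1Explicit (expUnit)
open BlockAveragingEMLLinearisedBackground (covWalkSum)
open Summit.QuantumFields.YangMills.Theorems.Prop8Chart (emlIterU)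
open Summit.QuantumFields.YangMills.Theorems.Prop8ChartAllL (coe_emlIterU_unitsField_T3_allL)
open Summit.QuantumFields.YangMills.Theorems.Prop7SymAvgTwSym (frameAccU frameTwS QTwS)
open Summit.QuantumFields.YangMills.Theorems.Prop7SymFrameLinearResponseStep (frameTwS_family_eq)
open Summit.QuantumFields.YangMills.Theorems.Prop7QSymEqTrueLinIter (QTwS_apply_eq_trueLinIter_sub_coarseGauge)
open Summit.QuantumFields.YangMills.Theorems.Prop7CoarseGaugeEqFrameResponse (fderiv_frameAccU_eq_coarseGauge)
open Summit.QuantumFields.YangMills.Theorems.Prop7EmlIterULinearPartEqTrueLinIter (fderiv_emlIterU_expUnit_apply_mul_star_eq_trueLinIter)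
open T3LevelShift (bondShift_src bondShift_tgt)

variable (F : T3Family) {n K : ℕ}

/-! ## ★★★ With LEG: the symmetric-frame twisted average is the true linearisation minus the STAIR-MEAN pure gauge — no residue -/

section WithLeg

variable (h : n ≤ K)

/-- ★★★ **`QTwS = Q_{K−n} − P_Ū(Λ^{stair}_{K−n})` EXACTLY** — LEG ✓`Prop7QSymEqTrueLinIter.QTwS_apply_eq_trueLinIter_sub_coarseGauge` (its hypotheses VERBATIM: windows, `RegPr`, the true-linearised
tower `Q` by `hQ0`∕`hQs`, 𝔰𝔲(2)-valued direction `A`) with the frames' linear response REPLACED by the stair-mean coarse gauge function `Λ_{K−n}` of ✓`Prop7CoarseGaugeEqFrameResponse` at the SU(2) tower of record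
(read at the fine sites `siteShift` of the coarse bond's endpoints): for this `CM` the «coarse-gauge residue» of w7-19200 g10's LOCATE (b1) §2 (v) is absent from the formula.  (With STRUCTURE instantiated at the
same `Q` and `CM`, the right side is the reduced part `G_{K−n}(ĉ)`; that instantiation is the (b1) pen's.) [cite: Balaban1985Averaging, (97) p.32, (58) p.27; Balaban1984PropagatorsI, (1.18)–(1.20) pp.19–20] -/
theorem QTwS_apply_eq_trueLinIter_sub_stairGauge {ε₀ : ℝ} (hε₀ : 0 < ε₀) (hε : 10 ^ 10 * (F.L : ℝ) ^ 6 * ε₀ ≤ 1) (hε12 : 10 ^ 12 * (F.L : ℝ) ^ 3 * ε₀ ≤ 1)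
    (W : GaugeField (F.P K) 0 (Matrix.specialUnitaryGroup (Fin 2) ℂ)) (hreg : RegPr F n K ε₀ W)
    (Q : (k : ℕ) → (PBond (F.P K) 0 → Matrix (Fin 2) (Fin 2) ℂ) → PBond (F.P K) k → Matrix (Fin 2) (Fin 2) ℂ) (hQ0 : ∀ Y, Q 0 Y = Y)
    (hQs : ∀ (k : ℕ) (Y : PBond (F.P K) 0 → Matrix (Fin 2) (Fin 2) ℂ) (c : PBond (F.P K) (k + 1)), Q (k + 1) Y c
      = fderiv ℂ (eml : (Idx (F.P K) → Matrix (Fin 2) (Fin 2) ℂ) → Matrix (Fin 2) (Fin 2) ℂ)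
            (fun i => ((loopHol (Averaging.iter (fun i => blockAvg (P := F.P K) (j := i) (expMeanLogSU (n := Fin 2))) k W) c i :
              Matrix.specialUnitaryGroup (Fin 2) ℂ) : Matrix (Fin 2) (Fin 2) ℂ))
            (fun i => covWalkSum (Averaging.iter (fun i => blockAvg (P := F.P K) (j := i) (expMeanLogSU (n := Fin 2))) k W) (Q k Y)
                (walk (emb c.src) (loopWord (F.P K).L c.dir (off i.1) i.2.1 i.2.2))
              * ((loopHol (Averaging.iter (fun i => blockAvg (P := F.P K) (j := i) (expMeanLogSU (n := Fin 2))) k W) c i :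
                Matrix.specialUnitaryGroup (Fin 2) ℂ) : Matrix (Fin 2) (Fin 2) ℂ))
            * star ((corr (expMeanLogSU (n := Fin 2)) (Averaging.iter (fun i => blockAvg (P := F.P K) (j := i) (expMeanLogSU (n := Fin 2))) k W) c :
                Matrix.specialUnitaryGroup (Fin 2) ℂ) : Matrix (Fin 2) (Fin 2) ℂ)
          + ((corr (expMeanLogSU (n := Fin 2)) (Averaging.iter (fun i => blockAvg (P := F.P K) (j := i) (expMeanLogSU (n := Fin 2))) k W) c :
                Matrix.specialUnitaryGroup (Fin 2) ℂ) : Matrix (Fin 2) (Fin 2) ℂ)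
            * covWalkSum (Averaging.iter (fun i => blockAvg (P := F.P K) (j := i) (expMeanLogSU (n := Fin 2))) k W) (Q k Y)
                (walk (emb c.src) (List.replicate (F.P K).L (c.dir, true)))
            * star ((corr (expMeanLogSU (n := Fin 2)) (Averaging.iter (fun i => blockAvg (P := F.P K) (j := i) (expMeanLogSU (n := Fin 2))) k W) c :
                Matrix.specialUnitaryGroup (Fin 2) ℂ) : Matrix (Fin 2) (Fin 2) ℂ))
    (A : PBond (F.P K) 0 → Matrix (Fin 2) (Fin 2) ℂ) (hA : ∀ b, A b ∈ skewAdjoint (Matrix (Fin 2) (Fin 2) ℂ)) (htr : ∀ b, (A b).trace = 0)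
    (c : PBond (F.P n) 0)
    (Λ : (k : ℕ) → Site (F.P K) k → Matrix (Fin 2) (Fin 2) ℂ) (hΛ0 : ∀ x, Λ 0 x = 0)
    (hΛs : ∀ (k : ℕ), k + 1 ≤ K - n → ∀ y : Site (F.P K) (k + 1),
      Λ (k + 1) y = (Fintype.card (Idx (F.P K)) : ℂ)⁻¹ • (∑ i : Idx (F.P K),
          covWalkSum (Averaging.iter (fun i => blockAvg (P := F.P K) (j := i) (expMeanLogSU (n := Fin 2))) k W)
            (fun b => (fderiv ℂ (fun t : PBond (F.P K) 0 → Matrix (Fin 2) (Fin 2) ℂ =>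
                ((emlIterU k (fun b' => expUnit (t b') * bgUnits F K W b') b : (Matrix (Fin 2) (Fin 2) ℂ)ˣ) : Matrix (Fin 2) (Fin 2) ℂ)) 0 A
              * star ((Averaging.iter (fun i => blockAvg (P := F.P K) (j := i) (expMeanLogSU (n := Fin 2))) k W b : Matrix.specialUnitaryGroup (Fin 2) ℂ) : Matrix (Fin 2) (Fin 2) ℂ))
              - (Λ k b.src - ((Averaging.iter (fun i => blockAvg (P := F.P K) (j := i) (expMeanLogSU (n := Fin 2))) k W b : Matrix.specialUnitaryGroup (Fin 2) ℂ) : Matrix (Fin 2) (Fin 2) ℂ) * Λ k b.tgt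
                  * star ((Averaging.iter (fun i => blockAvg (P := F.P K) (j := i) (expMeanLogSU (n := Fin 2))) k W b : Matrix.specialUnitaryGroup (Fin 2) ℂ) : Matrix (Fin 2) (Fin 2) ℂ)))
            (walk (emb y) (stairWord i.2.1 (off i.1))))
        + Λ k (emb y)) :
    QTwS F n K h W A c
      = Q (K - n) A (bondShift (sites_eq F n K h) c)
        - (Λ (K - n) (siteShift (sites_eq F n K h) c.src)
            - ((Averaging.iter (fun i => blockAvg (P := F.P K) (j := i) (expMeanLogSU (n := Fin 2))) (K - n) W (bondShift (sites_eq F n K h) c) :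
                Matrix.specialUnitaryGroup (Fin 2) ℂ) : Matrix (Fin 2) (Fin 2) ℂ)
              * Λ (K - n) (siteShift (sites_eq F n K h) c.tgt)
              * star ((Averaging.iter (fun i => blockAvg (P := F.P K) (j := i) (expMeanLogSU (n := Fin 2))) (K - n) W (bondShift (sites_eq F n K h) c) :
                Matrix.specialUnitaryGroup (Fin 2) ℂ) : Matrix (Fin 2) (Fin 2) ℂ)) := by
  -- the SU(2) tower of record carries the values of the units tower `Ū⁽ᵏ⁾[W♭]` (✓`coe_emlIterU_unitsField_T3_allL`, window `10⁷L³ε₀ ≤ 1 ⟸ 10¹²L³ε₀ ≤ 1`)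
  have hL3 : 0 ≤ (F.L : ℝ) ^ 3 * ε₀ := mul_nonneg (pow_nonneg (Nat.cast_nonneg _) 3) hε₀.le
  have hε7 : 10 ^ 7 * (F.L : ℝ) ^ 3 * ε₀ ≤ 1 := by nlinarith [hε12, hL3]
  have hV : ∀ k, k ≤ K - n → ∀ b : PBond (F.P K) k,
      ((emlIterU k (bgUnits F K W) b : (Matrix (Fin 2) (Fin 2) ℂ)ˣ) : Matrix (Fin 2) (Fin 2) ℂ)
        = ((Averaging.iter (fun i => blockAvg (P := F.P K) (j := i) (expMeanLogSU (n := Fin 2))) k W b : Matrix.specialUnitaryGroup (Fin 2) ℂ) :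
            Matrix (Fin 2) (Fin 2) ℂ) :=
    coe_emlIterU_unitsField_T3_allL F n K hε₀ hε7 W hreg.plaqSmall
  have hmain := fderiv_frameAccU_eq_coarseGauge F hε₀ hε12 W hreg
    (fun k => Averaging.iter (fun i => blockAvg (P := F.P K) (j := i) (expMeanLogSU (n := Fin 2))) k W) hV A Λ hΛ0 hΛs (K - n) le_rfl
  rw [QTwS_apply_eq_trueLinIter_sub_coarseGauge F h hε₀ hε hε12 W hreg Q hQ0 hQs A hA htr c,
    frameTwS_family_eq F h W c.src, frameTwS_family_eq F h W c.tgt, hmain, hmain]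

/-! ## ★★ The (R3) dock: `QTwS` IS the frame-reduced true linearisation at the shifted bond (✓`Prop7SkewFrobRowAssembly.skewFrobRow_of_rows`'s `hR3` by name) -/

/-- ★★ **THE (R3) DOCK.**  Under ★★★'s hypotheses, for every unit-lattice bond `c'` of the member: `QTwS W A c'` equals the FRAME-REDUCED true linearisation
`ℓ_{K−n}A(c) − (Λ_{K−n}(c₋) − Ū(c)·Λ_{K−n}(c₊)·Ū(c)⋆)` at `c := bondShift c'`, with `ℓ_{K−n}A(c) = fderiv (t ↦ ↑Ū⁽ᴷ⁻ⁿ⁾[eᵗ·W♭](c)) 0 A · ↑(Ū⁽ᴷ⁻ⁿ⁾W c)⋆` written EXACTLY as the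
summand of ✓`Prop7TrueLinIterDefectOfStairGauge.sqrt_sum_normSq_frameReduced_sub_lineIter_le_of_regPr` (ym-routeR-w4 g25, p746096) at `k = K − n` and `c.src`∕`c.tgt` left unreduced —
so that ✓`Prop7SkewFrobRowAssembly.skewFrobRow_of_rows`'s binder `hR3 : ∀ c', QTwS F n K h U₀ A c' = G (bondShift (sites_eq F n K h) c')` is this theorem at
`G := fun c ↦ ⟨that summand⟩` (β-definitionally), and its `hR2` is p746096 §3 at the same `G`.  Proof: ★★★, then `ℓ_{K−n}A = Q (K − n) A`
(✓`Prop7EmlIterULinearPartEqTrueLinIter.fderiv_emlIterU_expUnit_apply_mul_star_eq_trueLinIter`, same hypotheses) and `bondShift_src`∕`bondShift_tgt`.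
[cite: Balaban1985Averaging, (97) p.32, Prop. 3 (122)–(127) p.36; Balaban1984PropagatorsI, (1.18)–(1.20) pp.19–20] -/
theorem QTwS_apply_eq_frameReduced_bondShift {ε₀ : ℝ} (hε₀ : 0 < ε₀) (hε : 10 ^ 10 * (F.L : ℝ) ^ 6 * ε₀ ≤ 1) (hε12 : 10 ^ 12 * (F.L : ℝ) ^ 3 * ε₀ ≤ 1)
    (W : GaugeField (F.P K) 0 (Matrix.specialUnitaryGroup (Fin 2) ℂ)) (hreg : RegPr F n K ε₀ W)
    (Q : (k : ℕ) → (PBond (F.P K) 0 → Matrix (Fin 2) (Fin 2) ℂ) → PBond (F.P K) k → Matrix (Fin 2) (Fin 2) ℂ) (hQ0 : ∀ Y, Q 0 Y = Y)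
    (hQs : ∀ (k : ℕ) (Y : PBond (F.P K) 0 → Matrix (Fin 2) (Fin 2) ℂ) (c : PBond (F.P K) (k + 1)), Q (k + 1) Y c
      = fderiv ℂ (eml : (Idx (F.P K) → Matrix (Fin 2) (Fin 2) ℂ) → Matrix (Fin 2) (Fin 2) ℂ)
            (fun i => ((loopHol (Averaging.iter (fun i => blockAvg (P := F.P K) (j := i) (expMeanLogSU (n := Fin 2))) k W) c i :
              Matrix.specialUnitaryGroup (Fin 2) ℂ) : Matrix (Fin 2) (Fin 2) ℂ))
            (fun i => covWalkSum (Averaging.iter (fun i => blockAvg (P := F.P K) (j := i) (expMeanLogSU (n := Fin 2))) k W) (Q k Y)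
                (walk (emb c.src) (loopWord (F.P K).L c.dir (off i.1) i.2.1 i.2.2))
              * ((loopHol (Averaging.iter (fun i => blockAvg (P := F.P K) (j := i) (expMeanLogSU (n := Fin 2))) k W) c i :
                Matrix.specialUnitaryGroup (Fin 2) ℂ) : Matrix (Fin 2) (Fin 2) ℂ))
            * star ((corr (expMeanLogSU (n := Fin 2)) (Averaging.iter (fun i => blockAvg (P := F.P K) (j := i) (expMeanLogSU (n := Fin 2))) k W) c :
                Matrix.specialUnitaryGroup (Fin 2) ℂ) : Matrix (Fin 2) (Fin 2) ℂ)
          + ((corr (expMeanLogSU (n := Fin 2)) (Averaging.iter (fun i => blockAvg (P := F.P K) (j := i) (expMeanLogSU (n := Fin 2))) k W) c :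
                Matrix.specialUnitaryGroup (Fin 2) ℂ) : Matrix (Fin 2) (Fin 2) ℂ)
            * covWalkSum (Averaging.iter (fun i => blockAvg (P := F.P K) (j := i) (expMeanLogSU (n := Fin 2))) k W) (Q k Y)
                (walk (emb c.src) (List.replicate (F.P K).L (c.dir, true)))
            * star ((corr (expMeanLogSU (n := Fin 2)) (Averaging.iter (fun i => blockAvg (P := F.P K) (j := i) (expMeanLogSU (n := Fin 2))) k W) c :
                Matrix.specialUnitaryGroup (Fin 2) ℂ) : Matrix (Fin 2) (Fin 2) ℂ))
    (A : PBond (F.P K) 0 → Matrix (Fin 2) (Fin 2) ℂ) (hA : ∀ b, A b ∈ skewAdjoint (Matrix (Fin 2) (Fin 2) ℂ)) (htr : ∀ b, (A b).trace = 0)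
    (Λ : (k : ℕ) → Site (F.P K) k → Matrix (Fin 2) (Fin 2) ℂ) (hΛ0 : ∀ x, Λ 0 x = 0)
    (hΛs : ∀ (k : ℕ), k + 1 ≤ K - n → ∀ y : Site (F.P K) (k + 1),
      Λ (k + 1) y = (Fintype.card (Idx (F.P K)) : ℂ)⁻¹ • (∑ i : Idx (F.P K),
          covWalkSum (Averaging.iter (fun i => blockAvg (P := F.P K) (j := i) (expMeanLogSU (n := Fin 2))) k W)
            (fun b => (fderiv ℂ (fun t : PBond (F.P K) 0 → Matrix (Fin 2) (Fin 2) ℂ =>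
                ((emlIterU k (fun b' => expUnit (t b') * bgUnits F K W b') b : (Matrix (Fin 2) (Fin 2) ℂ)ˣ) : Matrix (Fin 2) (Fin 2) ℂ)) 0 A
              * star ((Averaging.iter (fun i => blockAvg (P := F.P K) (j := i) (expMeanLogSU (n := Fin 2))) k W b : Matrix.specialUnitaryGroup (Fin 2) ℂ) : Matrix (Fin 2) (Fin 2) ℂ))
              - (Λ k b.src - ((Averaging.iter (fun i => blockAvg (P := F.P K) (j := i) (expMeanLogSU (n := Fin 2))) k W b : Matrix.specialUnitaryGroup (Fin 2) ℂ) : Matrix (Fin 2) (Fin 2) ℂ) * Λ k b.tgt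
                  * star ((Averaging.iter (fun i => blockAvg (P := F.P K) (j := i) (expMeanLogSU (n := Fin 2))) k W b : Matrix.specialUnitaryGroup (Fin 2) ℂ) : Matrix (Fin 2) (Fin 2) ℂ)))
            (walk (emb y) (stairWord i.2.1 (off i.1))))
        + Λ k (emb y)) :
    ∀ c' : PBond (F.P n) 0,
      QTwS F n K h W A c'
        = (fderiv ℂ (fun t : PBond (F.P K) 0 → Matrix (Fin 2) (Fin 2) ℂ =>
              ((emlIterU (K - n) (fun b' => expUnit (t b') * bgUnits F K W b') (bondShift (sites_eq F n K h) c') : (Matrix (Fin 2) (Fin 2) ℂ)ˣ) : Matrix (Fin 2) (Fin 2) ℂ)) 0 A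
            * star ((Averaging.iter (fun i => blockAvg (P := F.P K) (j := i) (expMeanLogSU (n := Fin 2))) (K - n) W (bondShift (sites_eq F n K h) c') : Matrix.specialUnitaryGroup (Fin 2) ℂ) : Matrix (Fin 2) (Fin 2) ℂ))
          - (Λ (K - n) (bondShift (sites_eq F n K h) c').src
              - ((Averaging.iter (fun i => blockAvg (P := F.P K) (j := i) (expMeanLogSU (n := Fin 2))) (K - n) W (bondShift (sites_eq F n K h) c') : Matrix.specialUnitaryGroup (Fin 2) ℂ) : Matrix (Fin 2) (Fin 2) ℂ) * Λ (K - n) (bondShift (sites_eq F n K h) c').tgt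
                * star ((Averaging.iter (fun i => blockAvg (P := F.P K) (j := i) (expMeanLogSU (n := Fin 2))) (K - n) W (bondShift (sites_eq F n K h) c') : Matrix.specialUnitaryGroup (Fin 2) ℂ) : Matrix (Fin 2) (Fin 2) ℂ)) := by
  intro c'
  rw [QTwS_apply_eq_trueLinIter_sub_stairGauge F h hε₀ hε hε12 W hreg Q hQ0 hQs A hA htr c' Λ hΛ0 hΛs,
    fderiv_emlIterU_expUnit_apply_mul_star_eq_trueLinIter F hε₀ hε hε12 W hreg Q hQ0 hQs A hA htr le_rfl, bondShift_src, bondShift_tgt]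
  rfl

/-! ## ★ v3: the stair-mean coarse gauge family EXISTS (no definition: `Nat.rec`), and the (R3) dock packaged with it -/

/-- ★ **The stair-mean coarse gauge family exists.**  For every background `W` and direction `A` there is a family `Λ : (k : ℕ) → Site (F.P K) k → M₂(ℂ)` with `Λ 0 = 0` and
the COUPLED stair-mean recursion of ★★★'s `hΛs` at EVERY level (no window, no regularity: it is a recursion, built by `Nat.rec`; the tree's ✓`Prop7CurvedLandauRowA.exists_coarseGauge_family`
is the uncoupled version for a GIVEN reduced family).  Consumers feed ★★★∕★★ with `fun k _ y => h.2 k y`. [cite: Balaban1984PropagatorsI, (1.18)–(1.20) pp.19–20; Balaban1985Averaging, (58) p.27] -/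
theorem exists_stairGauge_family (W : GaugeField (F.P K) 0 (Matrix.specialUnitaryGroup (Fin 2) ℂ)) (A : PBond (F.P K) 0 → Matrix (Fin 2) (Fin 2) ℂ) :
    ∃ Λ : (k : ℕ) → Site (F.P K) k → Matrix (Fin 2) (Fin 2) ℂ, (∀ x, Λ 0 x = 0) ∧
      ∀ (k : ℕ) (y : Site (F.P K) (k + 1)),
      Λ (k + 1) y = (Fintype.card (Idx (F.P K)) : ℂ)⁻¹ • (∑ i : Idx (F.P K),
          covWalkSum (Averaging.iter (fun i => blockAvg (P := F.P K) (j := i) (expMeanLogSU (n := Fin 2))) k W)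
            (fun b => (fderiv ℂ (fun t : PBond (F.P K) 0 → Matrix (Fin 2) (Fin 2) ℂ =>
                ((emlIterU k (fun b' => expUnit (t b') * bgUnits F K W b') b : (Matrix (Fin 2) (Fin 2) ℂ)ˣ) : Matrix (Fin 2) (Fin 2) ℂ)) 0 A
              * star ((Averaging.iter (fun i => blockAvg (P := F.P K) (j := i) (expMeanLogSU (n := Fin 2))) k W b : Matrix.specialUnitaryGroup (Fin 2) ℂ) : Matrix (Fin 2) (Fin 2) ℂ))
              - (Λ k b.src - ((Averaging.iter (fun i => blockAvg (P := F.P K) (j := i) (expMeanLogSU (n := Fin 2))) k W b : Matrix.specialUnitaryGroup (Fin 2) ℂ) : Matrix (Fin 2) (Fin 2) ℂ) * Λ k b.tgt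
                  * star ((Averaging.iter (fun i => blockAvg (P := F.P K) (j := i) (expMeanLogSU (n := Fin 2))) k W b : Matrix.specialUnitaryGroup (Fin 2) ℂ) : Matrix (Fin 2) (Fin 2) ℂ)))
            (walk (emb y) (stairWord i.2.1 (off i.1))))
        + Λ k (emb y) := by
  refine ⟨fun k => Nat.rec (motive := fun k => Site (F.P K) k → Matrix (Fin 2) (Fin 2) ℂ) (fun _ => 0)
    (fun k Λk => fun y => (Fintype.card (Idx (F.P K)) : ℂ)⁻¹ • (∑ i : Idx (F.P K),
          covWalkSum (Averaging.iter (fun i => blockAvg (P := F.P K) (j := i) (expMeanLogSU (n := Fin 2))) k W)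
            (fun b => (fderiv ℂ (fun t : PBond (F.P K) 0 → Matrix (Fin 2) (Fin 2) ℂ =>
                ((emlIterU k (fun b' => expUnit (t b') * bgUnits F K W b') b : (Matrix (Fin 2) (Fin 2) ℂ)ˣ) : Matrix (Fin 2) (Fin 2) ℂ)) 0 A
              * star ((Averaging.iter (fun i => blockAvg (P := F.P K) (j := i) (expMeanLogSU (n := Fin 2))) k W b : Matrix.specialUnitaryGroup (Fin 2) ℂ) : Matrix (Fin 2) (Fin 2) ℂ))
              - (Λk b.src - ((Averaging.iter (fun i => blockAvg (P := F.P K) (j := i) (expMeanLogSU (n := Fin 2))) k W b : Matrix.specialUnitaryGroup (Fin 2) ℂ) : Matrix (Fin 2) (Fin 2) ℂ) * Λk b.tgt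
                  * star ((Averaging.iter (fun i => blockAvg (P := F.P K) (j := i) (expMeanLogSU (n := Fin 2))) k W b : Matrix.specialUnitaryGroup (Fin 2) ℂ) : Matrix (Fin 2) (Fin 2) ℂ)))
            (walk (emb y) (stairWord i.2.1 (off i.1))))
        + Λk (emb y)) k, fun _ => rfl, fun _ _ => rfl⟩

/-- ★★ **The (R3) dock, packaged**: under LEG's hypotheses alone (no `Λ` binder) there EXISTS a stair-mean coarse gauge family `Λ` (★ above) with ★★★'s `hΛ0`∕`hΛs` rows VERBATIM
and the (R3) identity of ★★ for it — one `obtain ⟨Λ, hΛ0, hΛs, hR3⟩` for the final knit, the same `Λ`∕`hΛs` then feeding ✓`Prop7TrueLinIterDefectOfStairGauge` §3 for (R2).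
[cite: Balaban1985Averaging, (97) p.32; Balaban1984PropagatorsI, (1.18)–(1.20) pp.19–20] -/
theorem exists_stairGauge_frameReduced_bondShift {ε₀ : ℝ} (hε₀ : 0 < ε₀) (hε : 10 ^ 10 * (F.L : ℝ) ^ 6 * ε₀ ≤ 1) (hε12 : 10 ^ 12 * (F.L : ℝ) ^ 3 * ε₀ ≤ 1)
    (W : GaugeField (F.P K) 0 (Matrix.specialUnitaryGroup (Fin 2) ℂ)) (hreg : RegPr F n K ε₀ W)
    (Q : (k : ℕ) → (PBond (F.P K) 0 → Matrix (Fin 2) (Fin 2) ℂ) → PBond (F.P K) k → Matrix (Fin 2) (Fin 2) ℂ) (hQ0 : ∀ Y, Q 0 Y = Y)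
    (hQs : ∀ (k : ℕ) (Y : PBond (F.P K) 0 → Matrix (Fin 2) (Fin 2) ℂ) (c : PBond (F.P K) (k + 1)), Q (k + 1) Y c
      = fderiv ℂ (eml : (Idx (F.P K) → Matrix (Fin 2) (Fin 2) ℂ) → Matrix (Fin 2) (Fin 2) ℂ)
            (fun i => ((loopHol (Averaging.iter (fun i => blockAvg (P := F.P K) (j := i) (expMeanLogSU (n := Fin 2))) k W) c i :
              Matrix.specialUnitaryGroup (Fin 2) ℂ) : Matrix (Fin 2) (Fin 2) ℂ))
            (fun i => covWalkSum (Averaging.iter (fun i => blockAvg (P := F.P K) (j := i) (expMeanLogSU (n := Fin 2))) k W) (Q k Y)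
                (walk (emb c.src) (loopWord (F.P K).L c.dir (off i.1) i.2.1 i.2.2))
              * ((loopHol (Averaging.iter (fun i => blockAvg (P := F.P K) (j := i) (expMeanLogSU (n := Fin 2))) k W) c i :
                Matrix.specialUnitaryGroup (Fin 2) ℂ) : Matrix (Fin 2) (Fin 2) ℂ))
            * star ((corr (expMeanLogSU (n := Fin 2)) (Averaging.iter (fun i => blockAvg (P := F.P K) (j := i) (expMeanLogSU (n := Fin 2))) k W) c :
                Matrix.specialUnitaryGroup (Fin 2) ℂ) : Matrix (Fin 2) (Fin 2) ℂ)
          + ((corr (expMeanLogSU (n := Fin 2)) (Averaging.iter (fun i => blockAvg (P := F.P K) (j := i) (expMeanLogSU (n := Fin 2))) k W) c :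
                Matrix.specialUnitaryGroup (Fin 2) ℂ) : Matrix (Fin 2) (Fin 2) ℂ)
            * covWalkSum (Averaging.iter (fun i => blockAvg (P := F.P K) (j := i) (expMeanLogSU (n := Fin 2))) k W) (Q k Y)
                (walk (emb c.src) (List.replicate (F.P K).L (c.dir, true)))
            * star ((corr (expMeanLogSU (n := Fin 2)) (Averaging.iter (fun i => blockAvg (P := F.P K) (j := i) (expMeanLogSU (n := Fin 2))) k W) c :
                Matrix.specialUnitaryGroup (Fin 2) ℂ) : Matrix (Fin 2) (Fin 2) ℂ))
    (A : PBond (F.P K) 0 → Matrix (Fin 2) (Fin 2) ℂ) (hA : ∀ b, A b ∈ skewAdjoint (Matrix (Fin 2) (Fin 2) ℂ)) (htr : ∀ b, (A b).trace = 0) :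
    ∃ Λ : (k : ℕ) → Site (F.P K) k → Matrix (Fin 2) (Fin 2) ℂ, (∀ x, Λ 0 x = 0) ∧
      (∀ (k : ℕ), k + 1 ≤ K - n → ∀ y : Site (F.P K) (k + 1),
      Λ (k + 1) y = (Fintype.card (Idx (F.P K)) : ℂ)⁻¹ • (∑ i : Idx (F.P K),
          covWalkSum (Averaging.iter (fun i => blockAvg (P := F.P K) (j := i) (expMeanLogSU (n := Fin 2))) k W)
            (fun b => (fderiv ℂ (fun t : PBond (F.P K) 0 → Matrix (Fin 2) (Fin 2) ℂ =>
                ((emlIterU k (fun b' => expUnit (t b') * bgUnits F K W b') b : (Matrix (Fin 2) (Fin 2) ℂ)ˣ) : Matrix (Fin 2) (Fin 2) ℂ)) 0 A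
              * star ((Averaging.iter (fun i => blockAvg (P := F.P K) (j := i) (expMeanLogSU (n := Fin 2))) k W b : Matrix.specialUnitaryGroup (Fin 2) ℂ) : Matrix (Fin 2) (Fin 2) ℂ))
              - (Λ k b.src - ((Averaging.iter (fun i => blockAvg (P := F.P K) (j := i) (expMeanLogSU (n := Fin 2))) k W b : Matrix.specialUnitaryGroup (Fin 2) ℂ) : Matrix (Fin 2) (Fin 2) ℂ) * Λ k b.tgt
                  * star ((Averaging.iter (fun i => blockAvg (P := F.P K) (j := i) (expMeanLogSU (n := Fin 2))) k W b : Matrix.specialUnitaryGroup (Fin 2) ℂ) : Matrix (Fin 2) (Fin 2) ℂ)))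
            (walk (emb y) (stairWord i.2.1 (off i.1))))
        + Λ k (emb y)) ∧
    ∀ c' : PBond (F.P n) 0,
      QTwS F n K h W A c'
        = (fderiv ℂ (fun t : PBond (F.P K) 0 → Matrix (Fin 2) (Fin 2) ℂ =>
              ((emlIterU (K - n) (fun b' => expUnit (t b') * bgUnits F K W b') (bondShift (sites_eq F n K h) c') : (Matrix (Fin 2) (Fin 2) ℂ)ˣ) : Matrix (Fin 2) (Fin 2) ℂ)) 0 A
            * star ((Averaging.iter (fun i => blockAvg (P := F.P K) (j := i) (expMeanLogSU (n := Fin 2))) (K - n) W (bondShift (sites_eq F n K h) c') : Matrix.specialUnitaryGroup (Fin 2) ℂ) : Matrix (Fin 2) (Fin 2) ℂ))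
          - (Λ (K - n) (bondShift (sites_eq F n K h) c').src
              - ((Averaging.iter (fun i => blockAvg (P := F.P K) (j := i) (expMeanLogSU (n := Fin 2))) (K - n) W (bondShift (sites_eq F n K h) c') : Matrix.specialUnitaryGroup (Fin 2) ℂ) : Matrix (Fin 2) (Fin 2) ℂ) * Λ (K - n) (bondShift (sites_eq F n K h) c').tgt
                * star ((Averaging.iter (fun i => blockAvg (P := F.P K) (j := i) (expMeanLogSU (n := Fin 2))) (K - n) W (bondShift (sites_eq F n K h) c') : Matrix.specialUnitaryGroup (Fin 2) ℂ) : Matrix (Fin 2) (Fin 2) ℂ)) := by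
  obtain ⟨Λ, hΛ0, hΛs⟩ := exists_stairGauge_family F W A
  exact ⟨Λ, hΛ0, fun k _ y => hΛs k y,
    QTwS_apply_eq_frameReduced_bondShift F h hε₀ hε hε12 W hreg Q hQ0 hQs A hA htr Λ hΛ0 (fun k _ y => hΛs k y)⟩

end WithLeg

end Summit.QuantumFields.YangMills.Theorems.Prop7CoarseGaugeEqFrameResponseQTwS

end
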